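import Mathlib
import Summits.ValiantsHypothesis.ValiantsHypothesis.Theorems.LacunarySymmetroidMatrixDescartesMomentLaw
import Summits.ValiantsHypothesis.ValiantsHypothesis.Theorems.LacunarySymmetroidMatrixDescartesOneAlternation

/-!
# `MatrixDescartes` (stmt-ValiantsHypothesis-18050) — the DEFINITE-MOMENTS LAW, I: the window engine and
# «V + 1 alternating definite moments saturating the Rayleigh budget ⇒ Z₊ ≤ V·m»

HONEST FRAMING.  Cell `pub-symmetroid`, seat `val-sym-mdr-p2` (gen 14); helper file `--supports` the crux
`Theses.LacunarySymmetroid.MatrixDescartes`, NO closure claim.  A MAGNITUDE-free SECTOR theorem (hypotheses = finitely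
many POINTWISE definiteness conditions on the pencil's values plus a zero budget for its Rayleigh forms); nothing here
bears on the crux in its window, on `stub_twoSided`, on `DoorA26`/`DoorA34`, registers, or `VP ≠ VNP`.

SETTING.  `F(x) = ∑ₖ x^{dₖ} Sₖ`, real symmetric `ι × ι` letters over any finite letter type `κ`, any natural exponents;
Rayleigh forms `f_v(x) = vᵀF(x)v = ∑ₖ x^{dₖ}·vᵀSₖv`.

THEOREM A (WINDOW ENGINE, `card_roots_window_le`).  If `F(a)` and `F(b)` are DEFINITE OF OPPOSITE SIGNS
(`c·f_v(a) > 0 > c·f_v(b)` for all `v ≠ 0`) and every `f_v` (`v ≠ 0`) has AT MOST ONE zero in `(a, b)`, then `det F`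
has at most `card ι` distinct zeros in `(a, b)`.  MECHANISM (Duffin's nested cones for overdamped systems / Markus'
spectral zones): each `f_v` changes sign exactly once in the window, always in the same direction, so the negative cones
`{v : f_v(x) < 0}` are NESTED in `x`, the inertia of `F(x)` is monotone across the window and jumps by `dim ker F(x₀)` at
every zero.  In Lean the scalar window lemmas (`scalar_up` / `scalar_down`, intermediate value theorem + one-zero
budget) are exactly the propagation hypothesis of the tree's DIRECTED KERNEL CHAIN `MomentLaw.card_le_of_directed`.
No Loewner monotonicity, no dominance margin, no semidefinite letter is assumed.

THEOREM B (`card_posRoots_le_of_definiteMoments`).  If every `f_v` (`v ≠ 0`) has at most `V` distinct positive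
zeros (BUDGET) and `F` is DEFINITE WITH ALTERNATING SIGNS at scales `0 < a₀ < ⋯ < a_V` (`σ(−1)ʲ F(aⱼ) ≻ 0`), then
every positive zero of `det F` lies in a gap `(aⱼ, aⱼ₊₁)` (`posRoot_mem_gap`), each gap is a window of Theorem A, and
`Z₊ ≤ V · card ι`.  Companions: `…DefiniteMomentsDescartes` (budget `K − 1` from Descartes' rule on the Rayleigh
`K`-nomial: «K alternating definite moments ⇒ Z₊ ≤ (K−1)·m», the lacunary certificate form of
[cite: CameronPsarrakos2019, Thm 3] — the hyperbolic case, recorded NOT TYPED in the tree's Literature port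
`…CameronPsarrakos2019.Rules`) and `…DefiniteMomentsWord` (semidefinite sign words, `V − 1` interior moments).
NEIGHBOURS in the tree: `oneAlternation` (V = 1, no test point), `negMoment_posRoots_le` (one pivot letter),
`dominantMiddle` / `signWord_posRoots_le` (semidefinite words under derivative-weighted DOMINANCE inequalities) —
here the hypotheses are signs of `F` at finitely many points and the letters are unrestricted.
[folklore] mechanism; elementary given the tree engines; axioms `propext`, `Classical.choice`, `Quot.sound`.
-/

-- layout Summits/ValiantsHypothesis/ValiantsHypothesis forces the duplicated namespace component
set_option linter.dupNamespace false

namespace Summit.ValiantsHypothesis.ValiantsHypothesis.Theorems.LacunarySymmetroidMatrixDescartes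

open Polynomial Matrix Finset
open scoped BigOperators

namespace DefiniteMoments

/-! ## §1 Scalar window lemmas: one zero between values of opposite sign ⇒ directed sign propagation -/

/-- **Scalar window lemma, up-crossing.**  `f` continuous, `f a < 0 < f b`, at most one zero of `f` in `(a, b)`:
then for `a < s < t < b`, `0 ≤ f s` forces `0 < f t` (otherwise the intermediate value theorem produces a zero in
`(a, s]` and another one in `[t, b)`). [folklore] -/
theorem scalar_up {f : ℝ → ℝ} (hf : Continuous f) {a b : ℝ} (ha : f a < 0) (hb : 0 < f b)
    (hone : ∀ r₁ r₂ : ℝ, a < r₁ → r₁ < b → a < r₂ → r₂ < b → f r₁ = 0 → f r₂ = 0 → r₁ = r₂)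
    {s t : ℝ} (hs : a < s) (hst : s < t) (ht : t < b) (hfs : 0 ≤ f s) : 0 < f t := by
  by_contra hft
  push Not at hft
  obtain ⟨r₁, hr₁, hfr₁⟩ : (0 : ℝ) ∈ f '' Set.Icc a s :=
    intermediate_value_Icc hs.le hf.continuousOn ⟨ha.le, hfs⟩
  obtain ⟨r₂, hr₂, hfr₂⟩ : (0 : ℝ) ∈ f '' Set.Icc t b :=
    intermediate_value_Icc ht.le hf.continuousOn ⟨hft, hb.le⟩
  have hr₁a : a < r₁ := lt_of_le_of_ne hr₁.1 (by rintro rfl; rw [hfr₁] at ha; exact lt_irrefl 0 ha)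
  have hr₂b : r₂ < b := lt_of_le_of_ne hr₂.2 (by rintro rfl; rw [hfr₂] at hb; exact lt_irrefl 0 hb)
  have h := hone r₁ r₂ hr₁a (by linarith [hr₁.2]) (by linarith [hr₂.1]) hr₂b hfr₁ hfr₂
  linarith [hr₁.2, hr₂.1]

/-- **Scalar window lemma, down-crossing.**  `f` continuous, `f a > 0 > f b`, at most one zero in `(a, b)`: then
for `a < s < t < b`, `0 ≤ f t` forces `0 < f s`. [folklore] -/
theorem scalar_down {f : ℝ → ℝ} (hf : Continuous f) {a b : ℝ} (ha : 0 < f a) (hb : f b < 0)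
    (hone : ∀ r₁ r₂ : ℝ, a < r₁ → r₁ < b → a < r₂ → r₂ < b → f r₁ = 0 → f r₂ = 0 → r₁ = r₂)
    {s t : ℝ} (hs : a < s) (hst : s < t) (ht : t < b) (hft : 0 ≤ f t) : 0 < f s := by
  by_contra hfs
  push Not at hfs
  obtain ⟨r₁, hr₁, hfr₁⟩ : (0 : ℝ) ∈ f '' Set.Icc a s :=
    intermediate_value_Icc' hs.le hf.continuousOn ⟨hfs, ha.le⟩
  obtain ⟨r₂, hr₂, hfr₂⟩ : (0 : ℝ) ∈ f '' Set.Icc t b :=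
    intermediate_value_Icc' ht.le hf.continuousOn ⟨hb.le, hft⟩
  have hr₁a : a < r₁ := lt_of_le_of_ne hr₁.1 (by rintro rfl; rw [hfr₁] at ha; exact lt_irrefl 0 ha)
  have hr₂b : r₂ < b := lt_of_le_of_ne hr₂.2 (by rintro rfl; rw [hfr₂] at hb; exact lt_irrefl 0 hb)
  have h := hone r₁ r₂ hr₁a (by linarith [hr₁.2]) (by linarith [hr₂.1]) hr₂b hfr₁ hfr₂
  linarith [hr₁.2, hr₂.1]

/-! ## §2 The evaluated pencil and its Rayleigh forms -/

section Eval

variable {ι κ : Type} [Fintype ι] [Fintype κ]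

/-- The Rayleigh form of the evaluated pencil: `vᵀF(r)v = ∑ₖ r^{dₖ}·vᵀSₖv`. [folklore] -/
theorem form_eq_sum (d : κ → ℕ) (S : κ → Matrix ι ι ℝ) (v : ι → ℝ) (r : ℝ) :
    v ⬝ᵥ ((∑ k, r ^ d k • S k) *ᵥ v) = ∑ k, r ^ d k * (v ⬝ᵥ (S k *ᵥ v)) :=
  OneAlternation.dotProduct_family_mulVec (fun k => r ^ d k) S v

/-- The Rayleigh form `r ↦ vᵀF(r)v` is continuous (a real polynomial function). [folklore] -/
theorem continuous_form (d : κ → ℕ) (S : κ → Matrix ι ι ℝ) (v : ι → ℝ) :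
    Continuous fun r : ℝ => v ⬝ᵥ ((∑ k, r ^ d k • S k) *ᵥ v) := by
  have h : (fun r : ℝ => v ⬝ᵥ ((∑ k, r ^ d k • S k) *ᵥ v))
      = fun r => ∑ k, r ^ d k * (v ⬝ᵥ (S k *ᵥ v)) := funext fun r => form_eq_sum d S v r
  rw [h]
  exact continuous_finsetSum _ fun k _ => (continuous_pow (d k)).mul continuous_const

omit [Fintype ι] in
/-- The evaluated pencil is symmetric when the letters are. [folklore] -/
theorem isSymm_eval (d : κ → ℕ) (S : κ → Matrix ι ι ℝ) (hS : ∀ k, (S k).IsSymm) (r : ℝ) :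
    (∑ k, r ^ d k • S k).IsSymm := by
  unfold Matrix.IsSymm
  rw [Matrix.transpose_sum]
  exact Finset.sum_congr rfl fun k _ => by rw [Matrix.transpose_smul, (hS k).eq]

/-- Evaluating the determinant: `(det ∑ₖ X^{dₖ} Sₖ)(s) = det (∑ₖ s^{dₖ} Sₖ)`. [folklore] -/
theorem eval_det_pencil [DecidableEq ι] (d : κ → ℕ) (S : κ → Matrix ι ι ℝ) (s : ℝ) :
    (Matrix.det (∑ k, ((X : ℝ[X]) ^ d k) • (S k).map C)).eval s = (∑ k, s ^ d k • S k).det := by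
  have h := RingHom.map_det (Polynomial.evalRingHom s) (∑ k, ((X : ℝ[X]) ^ d k) • (S k).map C)
  rw [Polynomial.coe_evalRingHom] at h
  rw [h]
  congr 1
  ext i j
  simp only [RingHom.mapMatrix_apply, Matrix.map_apply, Matrix.smul_apply, Matrix.sum_apply,
    smul_eq_mul, Polynomial.coe_evalRingHom, Polynomial.eval_mul, Polynomial.eval_pow,
    Polynomial.eval_X, Polynomial.eval_C, Polynomial.eval_finsetSum]

/-- A point of `(a, b)`-filtered `roots.toFinset` of `det F` is a point of `(a, b)` where the evaluated pencil is
singular. [folklore] -/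
theorem det_eval_eq_zero_of_mem [DecidableEq ι] (d : κ → ℕ) (S : κ → Matrix ι ι ℝ) {x : ℝ}
    (hx : x ∈ (Matrix.det (∑ k, ((X : ℝ[X]) ^ d k) • (S k).map C)).roots.toFinset) :
    (∑ k, x ^ d k • S k).det = 0 := by
  rw [Multiset.mem_toFinset] at hx
  by_cases hdet : Matrix.det (∑ k, ((X : ℝ[X]) ^ d k) • (S k).map C) = 0
  · rw [hdet, Polynomial.roots_zero] at hx
    exact absurd hx (Multiset.notMem_zero x)
  · have h := (Polynomial.mem_roots hdet).1 hx
    rwa [Polynomial.IsRoot, eval_det_pencil] at h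

end Eval

/-! ## §3 THEOREM A — the window engine: definite ends of opposite sign + one zero per Rayleigh form -/

section Window

variable {ι κ : Type} [Fintype ι] [DecidableEq ι] [Fintype κ]

/-- **THEOREM A (window engine; Duffin–Markus nested cones).**  `F(x) = ∑ₖ x^{dₖ} Sₖ` with real symmetric letters;
a window `a < b` at whose ends `F` is DEFINITE OF OPPOSITE SIGNS — `c·vᵀF(a)v > 0 > c·vᵀF(b)v` for all `v ≠ 0` and one
real `c` — and in which every Rayleigh form `x ↦ vᵀF(x)v` (`v ≠ 0`) has AT MOST ONE zero.  Then `det (∑ₖ X^{dₖ} Sₖ)` has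
at most `card ι` distinct zeros in `(a, b)`: the Rayleigh signs propagate in one direction (`scalar_up` /
`scalar_down`), so the kernel vectors at the zeros form a directed chain (`MomentLaw.card_le_of_directed`) and are
linearly independent. [folklore] -/
theorem card_roots_window_le (d : κ → ℕ) (S : κ → Matrix ι ι ℝ) (hS : ∀ k, (S k).IsSymm) {a b : ℝ} (c : ℝ)
    (hFa : ∀ v : ι → ℝ, v ≠ 0 → 0 < c * (v ⬝ᵥ ((∑ k, a ^ d k • S k) *ᵥ v)))
    (hFb : ∀ v : ι → ℝ, v ≠ 0 → c * (v ⬝ᵥ ((∑ k, b ^ d k • S k) *ᵥ v)) < 0)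
    (hone : ∀ v : ι → ℝ, v ≠ 0 → ∀ r₁ r₂ : ℝ, a < r₁ → r₁ < b → a < r₂ → r₂ < b →
      v ⬝ᵥ ((∑ k, r₁ ^ d k • S k) *ᵥ v) = 0 → v ⬝ᵥ ((∑ k, r₂ ^ d k • S k) *ᵥ v) = 0 → r₁ = r₂) :
    ((Matrix.det (∑ k, ((X : ℝ[X]) ^ d k) • (S k).map C)).roots.toFinset.filter
        (fun t => a < t ∧ t < b)).card ≤ Fintype.card ι := by
  set R := (Matrix.det (∑ k, ((X : ℝ[X]) ^ d k) • (S k).map C)).roots.toFinset.filter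
    (fun t => a < t ∧ t < b) with hR
  let τ : Fin R.card ↪o ℝ := R.orderEmbOfFin rfl
  have hτmem : ∀ j, τ j ∈ R := fun j => R.orderEmbOfFin_mem rfl j
  have hτin : ∀ j, τ j ∈ Set.Ioo a b := fun j => (Finset.mem_filter.1 (hτmem j)).2
  have hτdet : ∀ j, (∑ k, τ j ^ d k • S k).det = 0 := fun j =>
    det_eval_eq_zero_of_mem d S (Finset.mem_filter.1 (hτmem j)).1
  rcases lt_trichotomy c 0 with hc | hc | hc
  · -- `c < 0`: `F(a) ≺ 0 ≺ F(b)`, the Rayleigh signs propagate upwards; enumerate the zeros increasingly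
    refine MomentLaw.card_le_of_directed (fun x => ∑ k, x ^ d k • S k) (fun s t => s < t) (Set.Ioo a b)
      (fun s _ => isSymm_eval d S hS s) ?_ τ hτin (fun i j hij => τ.strictMono hij) hτdet
    intro s hs t ht hst v hv hsv
    have ha' : v ⬝ᵥ ((∑ k, a ^ d k • S k) *ᵥ v) < 0 := by
      rcases mul_pos_iff.1 (hFa v hv) with h | h
      · exact absurd h.1 (not_lt.2 hc.le)
      · exact h.2
    have hb' : 0 < v ⬝ᵥ ((∑ k, b ^ d k • S k) *ᵥ v) := by
      rcases mul_neg_iff.1 (hFb v hv) with h | h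
      · exact absurd h.1 (not_lt.2 hc.le)
      · exact h.2
    exact scalar_up (continuous_form d S v) ha' hb' (hone v hv) hs.1 hst ht.2 hsv
  · -- `c = 0` is only possible when there is no zero at all
    rcases Nat.eq_zero_or_pos R.card with h0 | hpos
    · rw [h0]; exact Nat.zero_le _
    · obtain ⟨v, hv, -⟩ := Matrix.exists_mulVec_eq_zero_iff.2 (hτdet ⟨0, hpos⟩)
      have h := hFa v hv
      rw [hc, zero_mul] at h
      exact absurd h (lt_irrefl 0)
  · -- `c > 0`: `F(a) ≻ 0 ≻ F(b)`, the signs propagate downwards; enumerate the zeros decreasingly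
    refine MomentLaw.card_le_of_directed (fun x => ∑ k, x ^ d k • S k) (fun s t => t < s) (Set.Ioo a b)
      (fun s _ => isSymm_eval d S hS s) ?_ (fun j => τ (Fin.rev j)) (fun j => hτin _)
      (fun i j hij => τ.strictMono (Fin.rev_lt_rev.2 hij)) (fun j => hτdet _)
    intro s hs t ht hts v hv hsv
    have ha' : 0 < v ⬝ᵥ ((∑ k, a ^ d k • S k) *ᵥ v) := by
      rcases mul_pos_iff.1 (hFa v hv) with h | h
      · exact h.2
      · exact absurd h.1 (not_lt.2 hc.le)
    have hb' : v ⬝ᵥ ((∑ k, b ^ d k • S k) *ᵥ v) < 0 := by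
      rcases mul_neg_iff.1 (hFb v hv) with h | h
      · exact h.2
      · exact absurd h.1 (not_lt.2 hc.le)
    exact scalar_down (continuous_form d S v) ha' hb' (hone v hv) ht.1 hts hs.2 hsv

end Window

/-! ## §4 THEOREM B — alternating definite moments saturating the Rayleigh budget -/

section Moments

variable {ι κ : Type} [Fintype ι] [DecidableEq ι] [Fintype κ]

omit [DecidableEq ι] in
/-- Consecutive test points of an alternating family have Rayleigh values of opposite strict signs, so every
Rayleigh form has a zero strictly between them. [folklore] -/
theorem exists_zero_in_gap (d : κ → ℕ) (S : κ → Matrix ι ι ℝ) {V : ℕ} (a : Fin (V + 1) → ℝ)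
    (ha : StrictMono a) (σ : ℝ)
    (hdef : ∀ (j : Fin (V + 1)) (v : ι → ℝ), v ≠ 0 →
      0 < σ * (-1) ^ (j : ℕ) * (v ⬝ᵥ ((∑ k, a j ^ d k • S k) *ᵥ v)))
    (v : ι → ℝ) (hv : v ≠ 0) (i : Fin V) :
    ∃ z : ℝ, a i.castSucc < z ∧ z < a i.succ ∧ v ⬝ᵥ ((∑ k, z ^ d k • S k) *ᵥ v) = 0 := by
  set f : ℝ → ℝ := fun r => v ⬝ᵥ ((∑ k, r ^ d k • S k) *ᵥ v) with hf
  have hcont : Continuous f := continuous_form d S v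
  have hlt : a i.castSucc < a i.succ := ha i.castSucc_lt_succ
  have h1 : 0 < σ * (-1) ^ (i : ℕ) * f (a i.castSucc) := by
    have h := hdef i.castSucc v hv
    rwa [Fin.val_castSucc] at h
  have h2 : σ * (-1) ^ (i : ℕ) * f (a i.succ) < 0 := by
    have h := hdef i.succ v hv
    rw [Fin.val_succ, pow_succ] at h
    have e : σ * ((-1) ^ (i : ℕ) * -1) * f (a i.succ) = -(σ * (-1) ^ (i : ℕ) * f (a i.succ)) := by ring
    rw [e] at h
    linarith
  rcases lt_trichotomy (σ * (-1) ^ (i : ℕ)) 0 with hc | hc | hc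
  · have hfa : f (a i.castSucc) < 0 := by
      rcases mul_pos_iff.1 h1 with h | h
      · exact absurd h.1 (not_lt.2 hc.le)
      · exact h.2
    have hfb : 0 < f (a i.succ) := by
      rcases mul_neg_iff.1 h2 with h | h
      · exact absurd h.1 (not_lt.2 hc.le)
      · exact h.2
    obtain ⟨z, hz, hfz⟩ : (0 : ℝ) ∈ f '' Set.Ioo (a i.castSucc) (a i.succ) :=
      intermediate_value_Ioo hlt.le hcont.continuousOn ⟨hfa, hfb⟩
    exact ⟨z, hz.1, hz.2, hfz⟩
  · rw [hc, zero_mul] at h1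
    exact absurd h1 (lt_irrefl 0)
  · have hfa : 0 < f (a i.castSucc) := by
      rcases mul_pos_iff.1 h1 with h | h
      · exact h.2
      · exact absurd h.1 (not_lt.2 hc.le)
    have hfb : f (a i.succ) < 0 := by
      rcases mul_neg_iff.1 h2 with h | h
      · exact h.2
      · exact absurd h.1 (not_lt.2 hc.le)
    obtain ⟨z, hz, hfz⟩ : (0 : ℝ) ∈ f '' Set.Ioo (a i.castSucc) (a i.succ) :=
      intermediate_value_Ioo' hlt.le hcont.continuousOn ⟨hfb, hfa⟩
    exact ⟨z, hz.1, hz.2, hfz⟩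

/-- The gaps `(aᵢ, aᵢ₊₁)` of a strictly increasing family are pairwise disjoint. [folklore] -/
theorem gap_eq_of_mem {V : ℕ} (a : Fin (V + 1) → ℝ) (ha : StrictMono a) (i i' : Fin V) (x : ℝ)
    (h1 : a i.castSucc < x) (h2 : x < a i.succ) (h3 : a i'.castSucc < x) (h4 : x < a i'.succ) : i = i' := by
  by_contra hne
  rcases lt_or_gt_of_ne hne with h | h
  · have hle : a i.succ ≤ a i'.castSucc := ha.monotone (by
      rw [Fin.le_def, Fin.val_succ, Fin.val_castSucc]; exact Fin.lt_def.1 h)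
    linarith
  · have hle : a i'.succ ≤ a i.castSucc := ha.monotone (by
      rw [Fin.le_def, Fin.val_succ, Fin.val_castSucc]; exact Fin.lt_def.1 h)
    linarith

omit [DecidableEq ι] in
/-- **Budget accounting.**  Under `V + 1` alternating definite moments and the budget «every Rayleigh form has at most
`V` distinct positive zeros», each Rayleigh form `f_v` (`v ≠ 0`) has a system of gap zeros `zᵢ ∈ (aᵢ, aᵢ₊₁)` and EVERY
positive zero of `f_v` is one of them. [folklore] -/
theorem gapZeros (d : κ → ℕ) (S : κ → Matrix ι ι ℝ) {V : ℕ} (a : Fin (V + 1) → ℝ) (ha : StrictMono a)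
    (ha0 : 0 < a 0) (σ : ℝ)
    (hdef : ∀ (j : Fin (V + 1)) (v : ι → ℝ), v ≠ 0 →
      0 < σ * (-1) ^ (j : ℕ) * (v ⬝ᵥ ((∑ k, a j ^ d k • S k) *ᵥ v)))
    (hbudget : ∀ v : ι → ℝ, v ≠ 0 → ∀ T : Finset ℝ,
      (∀ r ∈ T, 0 < r ∧ v ⬝ᵥ ((∑ k, r ^ d k • S k) *ᵥ v) = 0) → T.card ≤ V)
    (v : ι → ℝ) (hv : v ≠ 0) :
    ∃ z : Fin V → ℝ, (∀ i, a i.castSucc < z i ∧ z i < a i.succ ∧ v ⬝ᵥ ((∑ k, z i ^ d k • S k) *ᵥ v) = 0) ∧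
      ∀ x : ℝ, 0 < x → v ⬝ᵥ ((∑ k, x ^ d k • S k) *ᵥ v) = 0 → ∃ i, x = z i := by
  choose z hz1 hz2 hz3 using exists_zero_in_gap d S a ha σ hdef v hv
  refine ⟨z, fun i => ⟨hz1 i, hz2 i, hz3 i⟩, fun x hx hfx => ?_⟩
  have hzinj : Function.Injective z := fun i i' h =>
    gap_eq_of_mem a ha i i' (z i) (hz1 i) (hz2 i) (h ▸ hz1 i') (h ▸ hz2 i')
  by_contra hne
  push Not at hne
  have hxnot : x ∉ (Finset.univ : Finset (Fin V)).image z := by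
    rw [Finset.mem_image]
    rintro ⟨i, -, hi⟩
    exact hne i hi.symm
  have hT := hbudget v hv (insert x ((Finset.univ : Finset (Fin V)).image z)) (by
    intro r hr
    rw [Finset.mem_insert, Finset.mem_image] at hr
    rcases hr with rfl | ⟨i, -, rfl⟩
    · exact ⟨hx, hfx⟩
    · exact ⟨(ha0.trans_le (ha.monotone (Fin.zero_le _))).trans (hz1 i), hz3 i⟩)
  rw [Finset.card_insert_of_notMem hxnot, Finset.card_image_of_injective _ hzinj, Finset.card_univ,
    Fintype.card_fin] at hT
  omega

/-- **THEOREM B (alternating definite moments saturating the Rayleigh budget ⇒ `Z₊ ≤ V · card ι`).**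
`F(x) = ∑ₖ x^{dₖ} Sₖ`, real symmetric letters over any finite letter type, any natural exponents.  Hypotheses:
(i) BUDGET — for every `v ≠ 0` the Rayleigh form `x ↦ vᵀF(x)v` vanishes at no more than `V` distinct positive points;
(ii) MOMENTS — scales `0 < a₀ < ⋯ < a_V` with `σ(−1)ʲ·vᵀF(aⱼ)v > 0` for all `v ≠ 0` (alternating DEFINITE values).
Conclusion: `det (∑ₖ X^{dₖ} Sₖ)` has at most `V · card ι` distinct positive zeros — every one of them lies in a gap
`(aⱼ, aⱼ₊₁)` (a kernel vector's Rayleigh form vanishes there, and by `gapZeros` all its positive zeros are gap zeros),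
and each gap is a window of Theorem A. [folklore] (lacunary certificate form of [cite: CameronPsarrakos2019, Thm 3]) -/
theorem card_posRoots_le_of_definiteMoments (d : κ → ℕ) (S : κ → Matrix ι ι ℝ) (hS : ∀ k, (S k).IsSymm)
    (V : ℕ) (a : Fin (V + 1) → ℝ) (ha : StrictMono a) (ha0 : 0 < a 0) (σ : ℝ)
    (hdef : ∀ (j : Fin (V + 1)) (v : ι → ℝ), v ≠ 0 →
      0 < σ * (-1) ^ (j : ℕ) * (v ⬝ᵥ ((∑ k, a j ^ d k • S k) *ᵥ v)))
    (hbudget : ∀ v : ι → ℝ, v ≠ 0 → ∀ T : Finset ℝ,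
      (∀ r ∈ T, 0 < r ∧ v ⬝ᵥ ((∑ k, r ^ d k • S k) *ᵥ v) = 0) → T.card ≤ V) :
    ((Matrix.det (∑ k, ((X : ℝ[X]) ^ d k) • (S k).map C)).roots.toFinset.filter
        (fun t => 0 < t)).card ≤ V * Fintype.card ι := by
  set p := Matrix.det (∑ k, ((X : ℝ[X]) ^ d k) • (S k).map C) with hp
  -- each gap is a window of Theorem A
  have hwin : ∀ i : Fin V,
      (p.roots.toFinset.filter (fun t => a i.castSucc < t ∧ t < a i.succ)).card ≤ Fintype.card ι := by
    intro i
    refine card_roots_window_le d S hS (σ * (-1) ^ (i : ℕ)) ?_ ?_ ?_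
    · intro v hv
      have h := hdef i.castSucc v hv
      rwa [Fin.val_castSucc] at h
    · intro v hv
      have h := hdef i.succ v hv
      rw [Fin.val_succ, pow_succ] at h
      have e : σ * ((-1) ^ (i : ℕ) * -1) * (v ⬝ᵥ ((∑ k, a i.succ ^ d k • S k) *ᵥ v))
          = -(σ * (-1) ^ (i : ℕ) * (v ⬝ᵥ ((∑ k, a i.succ ^ d k • S k) *ᵥ v))) := by ring
      rw [e] at h
      linarith
    · intro v hv r₁ r₂ h1 h1' h2 h2' hf1 hf2
      obtain ⟨z, hz, hall⟩ := gapZeros d S a ha ha0 σ hdef hbudget v hv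
      have hpos : ∀ r, a i.castSucc < r → 0 < r := fun r hr =>
        (ha0.trans_le (ha.monotone (Fin.zero_le _))).trans hr
      obtain ⟨i₁, rfl⟩ := hall r₁ (hpos r₁ h1) hf1
      obtain ⟨i₂, rfl⟩ := hall r₂ (hpos r₂ h2) hf2
      have e₁ : i₁ = i := gap_eq_of_mem a ha i₁ i (z i₁) (hz i₁).1 (hz i₁).2.1 h1 h1'
      have e₂ : i₂ = i := gap_eq_of_mem a ha i₂ i (z i₂) (hz i₂).1 (hz i₂).2.1 h2 h2'
      rw [e₁, e₂]
  -- every positive zero lies in some gap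
  have hsub : p.roots.toFinset.filter (fun t => 0 < t) ⊆
      (Finset.univ : Finset (Fin V)).biUnion
        (fun i => p.roots.toFinset.filter (fun t => a i.castSucc < t ∧ t < a i.succ)) := by
    intro x hx
    rw [Finset.mem_filter] at hx
    obtain ⟨hxr, hx0⟩ := hx
    obtain ⟨v, hv, hFv⟩ := Matrix.exists_mulVec_eq_zero_iff.2 (det_eval_eq_zero_of_mem d S hxr)
    have hfx : v ⬝ᵥ ((∑ k, x ^ d k • S k) *ᵥ v) = 0 := by rw [hFv, dotProduct_zero]
    obtain ⟨z, hz, hall⟩ := gapZeros d S a ha ha0 σ hdef hbudget v hv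
    obtain ⟨i, rfl⟩ := hall x hx0 hfx
    rw [Finset.mem_biUnion]
    exact ⟨i, Finset.mem_univ _, Finset.mem_filter.2 ⟨hxr, (hz i).1, (hz i).2.1⟩⟩
  calc (p.roots.toFinset.filter (fun t => 0 < t)).card
      ≤ ((Finset.univ : Finset (Fin V)).biUnion
          (fun i => p.roots.toFinset.filter (fun t => a i.castSucc < t ∧ t < a i.succ))).card :=
        Finset.card_le_card hsub
    _ ≤ ∑ i : Fin V, (p.roots.toFinset.filter (fun t => a i.castSucc < t ∧ t < a i.succ)).card :=
        Finset.card_biUnion_le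
    _ ≤ ∑ _i : Fin V, Fintype.card ι := Finset.sum_le_sum fun i _ => hwin i
    _ = V * Fintype.card ι := by rw [Finset.sum_const, Finset.card_univ, Fintype.card_fin, smul_eq_mul]

/-- **Localisation.**  Under the hypotheses of Theorem B, `det F` has no positive zero outside the open gaps: none in
`(0, a₀]`, none at any `aⱼ`, none in `[a_V, ∞)`. [folklore] -/
theorem posRoot_mem_gap (d : κ → ℕ) (S : κ → Matrix ι ι ℝ)
    (V : ℕ) (a : Fin (V + 1) → ℝ) (ha : StrictMono a) (ha0 : 0 < a 0) (σ : ℝ)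
    (hdef : ∀ (j : Fin (V + 1)) (v : ι → ℝ), v ≠ 0 →
      0 < σ * (-1) ^ (j : ℕ) * (v ⬝ᵥ ((∑ k, a j ^ d k • S k) *ᵥ v)))
    (hbudget : ∀ v : ι → ℝ, v ≠ 0 → ∀ T : Finset ℝ,
      (∀ r ∈ T, 0 < r ∧ v ⬝ᵥ ((∑ k, r ^ d k • S k) *ᵥ v) = 0) → T.card ≤ V)
    {x : ℝ} (hx : 0 < x) (hdet : (∑ k, x ^ d k • S k).det = 0) :
    ∃ i : Fin V, a i.castSucc < x ∧ x < a i.succ := by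
  obtain ⟨v, hv, hFv⟩ := Matrix.exists_mulVec_eq_zero_iff.2 hdet
  have hfx : v ⬝ᵥ ((∑ k, x ^ d k • S k) *ᵥ v) = 0 := by rw [hFv, dotProduct_zero]
  obtain ⟨z, hz, hall⟩ := gapZeros d S a ha ha0 σ hdef hbudget v hv
  obtain ⟨i, rfl⟩ := hall x hx hfx
  exact ⟨i, (hz i).1, (hz i).2.1⟩

end Moments

end DefiniteMoments

end Summit.ValiantsHypothesis.ValiantsHypothesis.Theorems.LacunarySymmetroidMatrixDescartes
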